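import Summits.BirchSwinnertonDyer.Rank1Residual.Additive.TameBranchBudgetSqueeze
import Summits.BirchSwinnertonDyer.Rank1Residual.Additive.TameBranchKatoDivisibilityOfDelbourgo
import HarnessLib

/-!
# The UPPER half at `T = 0` from the RATIONAL Kato divisibility + `μ = 0` + integrality — NO unit
# coefficient, NO budget (route planner 2, ROUTE-2 §II.27 ST-27.2 "T1"; team n1011; lane
# CLASS-CLOSURE, seat cc-typer-2 = typer of record N10 §3.2 / O7 §3.3)

HONEST FRAMING (cell `b2b-bsdres`, run/shared/lean/b2b/bsd-rank1-residual/, verbatim in every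
file): the goal of the cell is to DELETE the COMBINATION-SHAPED residual classes of the
Birch–Swinnerton-Dyer formula for ALL analytic-rank `≤ 1` elliptic curves over `ℚ` — "full BSD
formula for every rank `≤ 1` curve in class `C`" assembled STRICTLY from published theorems — so
that the rank-`≤ 1` remainder becomes exactly the CONSTRUCTION-SHAPED classes, which are TYPED
(missing-input `Prop`s), NOT attempted. This is not "finishing BSD". Lane CLASS-CLOSURE: prove what
is provable now; shrink each hard class to its core with data; no claim beyond stated classes;
census / instrument output = EVIDENCE, never a Literature fact; RESIDUAL-MAP marks N10 / N11 / O7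
UNCHANGED; nothing is booked by this file. THEOREMS ONLY: 0 definitions, 0 named facts.

## What (r2 GEN 21, ROUTE-2 §II.27 READING A-UP + ST-27.2; first refusal to this seat, taken)

`TameBranchUpper.cycLeadingTermAt_of_tameBranchRatCharEq_of_hasUnitContent_of_integral` (p253244)
derives additive-p2's `CycLeadingTermAt W p` ("SOME element of `char_Λ X(E/ℚ_∞)` has constant term
`unit · L(E,1)/Ω_E`") from the cell's CONJECTURED rational main conjecture `TameBranchRatCharEqAt`.
READING A-UP (r2): the conjecture is not needed — the PRINTED Kato half suffices. From
`TameBranchRatDvdAt W p` (Delbourgo 2002 Thm. (C): `g ∈ char X`, `ι g = p^k · B_E`, `k ≥ 0`), the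
`p`-integrality of `B_E` (`hint`) and `μ^alg(E/ℚ_∞) = 0` (`hμ`: the generator of `char X` has unit
content — the μ-ANCHOR on e346 rows, Greenberg's conjecture in general): `B_E = ι g₀`,
`g = p^k · g₀`, and Gauss' lemma for the prime `p ∈ Λ` (`dvd_of_dvd_C_pow_mul_of_hasUnitContent`,
`TameBranchBudgetSqueeze.lean`) gives `fE ∣ g₀`, i.e. **`B_E ∈ ι(char_Λ X)`** — whence, with the
UPPER period binder (`α⁻¹·[0]⁺_f = u·q`, `u ∈ ℤ_pˣ`, `L(E,1) = q·Ω_E`), `CycLeadingTermAt W p`. NO unit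
coefficient of `B_E` (no tame-branch engine), NO Tamagawa budget, and the located residue
`ord_p(C⁺_E)` of `class-closure/N10/E346-KATO-INT-typer2.md` is moot on such rows (Delbourgo's (C) is
RATIONAL; integrality is restored by `μ = 0`, not by Kato's lattice constant).

* §1 per datum: `exists_mem_charIdeal_iota_eq_of_ratDvd_of_integral_of_hasUnitContent` (generator
  form) and `…_of_mu_zero` (`μ(D.X) = 0` form, finitely generated torsion data).
* §2 `T = 0` at the datum and the `W`-level predicate:
  `cycLeadingTermAt_of_tameBranchRatDvdAt_of_hasUnitContent_of_integral` (= T1, the `RatDvdAt`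
  sibling of `TameBranchUpper` l.118, binder-for-binder with `hT` weakened).
* §4 the `μ`-anchor interface: `hasUnitContent_of_charIdeal_eq_span_of_mu_zero` (`D.mu = 0` ⟹
  unit-content generator, `X` f.g. by `module_finite_holds`) and T1 / END in `D.mu` currency
  (`cycLeadingTermAt_of_tameBranchRatDvdAt_of_mu_zero_of_integral`,
  `ClassX4Gord.bsdp_rankZero_of_thmC_of_mu_zero_of_integral_of_shaAn_unit`).
* §3 composed ENDs on X4♯(G-ord), `p ≥ 5`, `r_an = 0`, `ord_p #Ш_an = 0`:
  `ClassX4Gord.bsdp_rankZero_of_tameBranchRatDvdAt_of_hasUnitContent_of_integral_of_shaAn_unit`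
  (`GordCycLeadingTerm.ClassX4Gord.bsdp_rankZero_of_cycLeadingTerm_of_shaAn_unit`), and the
  PRINTED-input form through `tameBranchRatDvdAt_of_thmC` (Delbourgo 2002 (A)+(C), non-CM).

r2's customers of record (EVIDENCE, nothing booked): the 6 Route-2 e346 rows with a rank-0 UNIT
MATCH partner {131100f1, 133350bm1, 233450cr1, 423150da1, 46200dg1, 499800el1} (all (5;4), W = 0) =
ANCHORED-PENDING {I1 KO certificate, I2 `PlusSymbolsPIntegralAt W 5`, T1 (this file), T2 μ-anchor
brick (p07), T3 partner `X(E₁/ℚ_∞) = 0` (p12/p04), F4}. What is NOT claimed: `μ = 0` on any row (an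
INPUT), the tuple's existence (the MTT prerequisite `IsTameBranchOf`), any per-pair binder; X4♯(G-ord)
stays CONSTRUCTION-SHAPED; nothing booked.

References: D. Delbourgo, J. Number Theory 95 (2002) Thm. (A), (C) [Delbourgo2002]; Compositio 113
(1998) Prop. 4, Main Conjecture p. 151 [Delbourgo1998]; L. Washington, GTM 83 §7.1, §13.1–13.2
[Washington1997]; B. Mazur, J. Tate, J. Teitelbaum, Invent. Math. 84 (1986) §I.13–14
[MazurTateTeitelbaum1986Invent].
-/

set_option autoImplicit false

noncomputable section

open scoped Classical MatrixGroups ModularForm NumberField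

open CongruenceSubgroup WeierstrassCurve NumberField Literature.NumberTheory.EllipticCurves
  Literature.NumberTheory.EllipticCurves.ModularForms
  Literature.NumberTheory.EllipticCurves.Rank1Residual
  Literature.NumberTheory.EllipticCurves.Rank1Residual.Typed
  Literature.NumberTheory.EllipticCurves.Delbourgo2002
  Literature.NumberTheory.EllipticCurves.GreenbergVatsal2000
  Summit.BirchSwinnertonDyer.Rank1Residual.X1.MuLambda
  Summit.BirchSwinnertonDyer.Rank1Residual.X1.ParitySqueeze
  Summit.BirchSwinnertonDyer.Rank1Residual.X11a
  Summit.BirchSwinnertonDyer.Rank1Residual.X11a.LambdaNorm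
  Summit.BirchSwinnertonDyer.Rank1Residual.Iwasawa
  IsDedekindDomain

open Summit.BirchSwinnertonDyer.Rank1Residual.X1.MuPart (mu_generator_eq_muInvariant)

namespace Summit.BirchSwinnertonDyer.Rank1Residual.Additive

variable {p : ℕ} [hp : Fact p.Prime]

/-! ### §1 Per datum: `B ∈ ι(char X)` from a rational divisibility, integrality and unit content -/

section Datum

variable {W : WeierstrassCurve ℚ} [W.IsElliptic] {κ : ZpExtension ℚ p} {γ : Field.absoluteGaloisGroup ℚ}

omit [W.IsElliptic] in
/-- **`B ∈ ι(char_Λ X)` — generator form.** If `char X = (fE)` with `fE` of unit content, `g ∈ char X`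
with `ι g = p^k · B` and `B` is `p`-integral, then `B = ι g₀` for some `g₀ ∈ char X` (`g = p^k g₀` by
injectivity of `ι`; `fE ∣ g₀` by Gauss' lemma for `p ∈ Λ`). [cite: Washington1997, §13.1–13.2] -/
theorem exists_mem_charIdeal_iota_eq_of_ratDvd_of_integral_of_hasUnitContent
    (D : W.SelmerDualData κ γ) {fE : IwasawaAlgebra p} (hchar : D.charIdeal = Ideal.span {fE})
    (hfE : HasUnitContent fE) {g : IwasawaAlgebra p} (hg : g ∈ D.charIdeal) {k : ℕ}
    {B : PowerSeries ℚ_[p]}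
    (hι : iwasawaToPowerSeries p g = PowerSeries.C ((p : ℚ_[p]) ^ k) * B)
    (hint : ∀ j : ℕ, ‖PowerSeries.coeff j B‖ ≤ 1) :
    ∃ g₀ ∈ D.charIdeal, iwasawaToPowerSeries p g₀ = B := by
  obtain ⟨g₀, hg₀⟩ := exists_iwasawaToPowerSeries_eq_of_norm_coeff_le_one hint
  have hgfac : g = PowerSeries.C ((p : ℤ_[p]) ^ k) * g₀ := by
    apply iwasawaToPowerSeries_injective p
    rw [hι, map_mul, Literature.NumberTheory.EllipticCurves.iwasawaToPowerSeries_C_natCast_pow p, hg₀]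
  have hdvd : fE ∣ PowerSeries.C ((p : ℤ_[p]) ^ k) * g₀ := by
    rw [← hgfac]
    rw [hchar] at hg
    exact Ideal.mem_span_singleton.mp hg
  refine ⟨g₀, ?_, hg₀⟩
  rw [hchar]
  exact Ideal.mem_span_singleton.mpr (dvd_of_dvd_C_pow_mul_of_hasUnitContent hfE k hdvd)

omit [W.IsElliptic] in
/-- **`B ∈ ι(char_Λ X)` — `μ = 0` form** (finitely generated torsion datum): `μ(D.X) = 0` makes the
generator of `char X` of unit content (`mu_generator_eq_muInvariant`). [cite: Washington1997, §13.2] -/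
theorem exists_mem_charIdeal_iota_eq_of_ratDvd_of_integral_of_mu_zero
    (D : W.SelmerDualData κ γ) [Module.Finite (IwasawaAlgebra p) D.X] (hX : D.IsTorsion)
    (hμ : D.mu = 0) {g : IwasawaAlgebra p} (hg : g ∈ D.charIdeal) {k : ℕ} {B : PowerSeries ℚ_[p]}
    (hι : iwasawaToPowerSeries p g = PowerSeries.C ((p : ℚ_[p]) ^ k) * B)
    (hint : ∀ j : ℕ, ‖PowerSeries.coeff j B‖ ≤ 1) :
    ∃ g₀ ∈ D.charIdeal, iwasawaToPowerSeries p g₀ = B := by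
  obtain ⟨fE, hchar, hfE0⟩ := exists_charIdeal_eq_span_ne_zero D
  have hμfE : mu fE = 0 := by
    rw [mu_generator_eq_muInvariant D.X hX hfE0 hchar]
    exact hμ
  exact exists_mem_charIdeal_iota_eq_of_ratDvd_of_integral_of_hasUnitContent D hchar
    (hasUnitContent_of_mu_eq_zero hfE0 hμfE) hg hι hint

end Datum

/-! ### §2 The tame branch: `T = 0` UPPER half from the rational Kato half (T1) -/

section TameBranch

variable {W : WeierstrassCurve ℚ} [W.IsElliptic] [W.IsGloballyMinimal]

/-- **T1 at the datum (`μ(D.X) = 0` form).** `E = W` globally minimal, `p ≠ 2` additive of type (M)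
or (G-ord), the typed Kato half `TameBranchRatDvdAt W p`, a tame-branch tuple `(f, ε, α, B)` with `B`
`p`-integral, the UPPER unit period binder, and a finitely generated cyclotomic datum `D` with
`μ(D.X) = 0`: SOME `c ∈ char_Λ X(W/ℚ_∞)` has `c(0) = u · q` (`L(E,1) = q · Ω_E`). No unit coefficient,
no budget. [cite: Delbourgo2002, Theorem (C) (p. 40)] [cite: MazurTateTeitelbaum1986Invent, §I.13–I.14] -/
theorem tameBranch_exists_constantCoeff_eq_unit_mul_of_ratDvd_of_integral_of_mu_zero
    (hT : TameBranchRatDvdAt W p)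
    {N : ℕ} [NeZero N] {f : CuspForm (Gamma0 N) 2} {ε : DirichletCharacter ℂ_[p] p} {α : ℚ_[p]}
    {B : PowerSeries ℚ_[p]}
    (hp2 : p ≠ 2) (hadd : Addv W p) (hloc : PotMult W p ∨ TypeGOrd W p)
    (hf : IsNewformOf W f) (hε : orderOf ε = tameDefect W p) (hα : ‖α‖ = 1)
    (hB : IsTameBranchOf f p ε α B) (hint : ∀ j : ℕ, ‖PowerSeries.coeff j B‖ ≤ 1)
    {q : ℚ} (hq : W.entireLFunction 1 = (q : ℂ) * (W.realPeriodRat : ℂ))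
    {u₀ : ℤ_[p]ˣ} (h0 : α⁻¹ * (ratPlusSymbol f 0 : ℚ_[p]) = ((u₀ : ℤ_[p]) : ℚ_[p]) * (q : ℚ_[p]))
    {κ : ZpExtension ℚ p} {γ : Field.absoluteGaloisGroup ℚ} (hκ : κ.IsCyclotomic)
    (hγ : κ.IsTopGenerator γ) (hcv : IsCyclotomicVariable p γ)
    (D : W.SelmerDualData κ γ) [Module.Finite (IwasawaAlgebra p) D.X] (hμ : D.mu = 0) :
    ∃ c ∈ D.charIdeal, ∃ u : ℤ_[p]ˣ, ∃ q : ℚ,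
      W.entireLFunction 1 = (q : ℂ) * (W.realPeriodRat : ℂ) ∧
      ((PowerSeries.constantCoeff c : ℤ_[p]) : ℚ_[p]) = ((u : ℤ_[p]) : ℚ_[p]) * (q : ℚ_[p]) := by
  obtain ⟨hX, g, hg, k, hι⟩ := hT ε α B hp2 hadd hloc hκ hγ hcv hf hε hα hB D
  obtain ⟨g₀, hmem, hg₀⟩ :=
    exists_mem_charIdeal_iota_eq_of_ratDvd_of_integral_of_mu_zero D hX hμ hg hι hint
  refine ⟨g₀, hmem, u₀, q, hq, ?_⟩
  rw [← constantCoeff_iwasawaToPowerSeries, hg₀, hB.constantCoeff, h0]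

/-- **T1 (r2 ST-27.2): `CycLeadingTermAt W p` from the RATIONAL Kato half, `μ^alg = 0` and
integrality** — the `TameBranchRatDvdAt` sibling of
`cycLeadingTermAt_of_tameBranchRatCharEq_of_hasUnitContent_of_integral` (`TameBranchUpper.lean`),
binder-for-binder with `hT` weakened from the conjectured equality to the printed divisibility.
Inputs: `TameBranchRatDvdAt W p` (Delbourgo 2002 (C), typed), a tame-branch tuple, `hμ` (EVERY
generator of `char_Λ X(W/ℚ_∞)` for every cyclotomic datum has unit content — Greenberg's `μ = 0`; on
e346 rows the μ-ANCHOR), `hint` (`B` `p`-integral), the UPPER unit period binder. READING A-UP: no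
tame engine, no budget, residue `ord_p(C⁺_E)` moot. X3♯/X4♯(G-ord), (M) stay CONSTRUCTION-SHAPED.
[cite: Delbourgo2002, Theorem (C) (p. 40)] [cite: Delbourgo1998, Main Conjecture (p. 151) (divisibility direction at `T = 0`; shape)]
[cite: MazurTateTeitelbaum1986Invent, §I.13–I.14 (constant term)] -/
theorem cycLeadingTermAt_of_tameBranchRatDvdAt_of_hasUnitContent_of_integral
    (hT : TameBranchRatDvdAt W p)
    {N : ℕ} [NeZero N] {f : CuspForm (Gamma0 N) 2} {ε : DirichletCharacter ℂ_[p] p} {α : ℚ_[p]}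
    {B : PowerSeries ℚ_[p]}
    (hp2 : p ≠ 2) (hadd : Addv W p) (hloc : PotMult W p ∨ TypeGOrd W p)
    (hf : IsNewformOf W f) (hε : orderOf ε = tameDefect W p) (hα : ‖α‖ = 1)
    (hB : IsTameBranchOf f p ε α B)
    (hμ : ∀ (κ : ZpExtension ℚ p) (γ : Field.absoluteGaloisGroup ℚ),
      κ.IsCyclotomic → κ.IsTopGenerator γ → IsCyclotomicVariable p γ →
      ∀ (D : W.SelmerDualData κ γ) (g : IwasawaAlgebra p), D.charIdeal = Ideal.span {g} →
        HasUnitContent g)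
    (hint : ∀ n : ℕ, ‖PowerSeries.coeff n B‖ ≤ 1)
    {q : ℚ} (hq : W.entireLFunction 1 = (q : ℂ) * (W.realPeriodRat : ℂ))
    {u : ℤ_[p]ˣ} (hu : α⁻¹ * (ratPlusSymbol f 0 : ℚ_[p]) = ((u : ℤ_[p]) : ℚ_[p]) * (q : ℚ_[p])) :
    CycLeadingTermAt W p := by
  intro κ γ hκ hγ hcv D
  obtain ⟨-, g, hg, k, hι⟩ := hT ε α B hp2 hadd hloc hκ hγ hcv hf hε hα hB D
  obtain ⟨fE, hchar, -⟩ := exists_charIdeal_eq_span_ne_zero D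
  obtain ⟨g₀, hmem, hg₀⟩ := exists_mem_charIdeal_iota_eq_of_ratDvd_of_integral_of_hasUnitContent D
    hchar (hμ κ γ hκ hγ hcv D fE hchar) hg hι hint
  refine ⟨g₀, hmem, u, q, hq, ?_⟩
  rw [← constantCoeff_iwasawaToPowerSeries, hg₀, hB.constantCoeff, hu]

/-! ### §3 Composed ENDs on X4♯(G-ord), `p ≥ 5`, `r_an = 0`, `ord_p #Ш_an = 0` -/

/-- **END (typed Kato half).** X4♯(G-ord), EVERY defect, `p ≥ 5`, analytic rank `0`, `ord_p #Ш_an = 0`: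
`BSD(E,p)` from `TameBranchRatDvdAt W p` + a `p`-integral tame branch + `μ^alg = 0` + the UPPER unit
period binder, through `CycLeadingTermAt` (T1) and additive-p2's
`ClassX4Gord.bsdp_rankZero_of_cycLeadingTerm_of_shaAn_unit` (Delbourgo 1998 Prop. 4 `hDel`, GZK,
modularity). r2's ANCHORED-PENDING row shape minus the instrument columns. Nothing booked.
[cite: Delbourgo1998, Prop. 4 (p. 144)] [cite: Delbourgo2002, Theorem (C) (p. 40)] -/
theorem ClassX4Gord.bsdp_rankZero_of_tameBranchRatDvdAt_of_hasUnitContent_of_integral_of_shaAn_unit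
    (hDel : Delbourgo1998.prop4_rankZero_pow_dvd_constantCoeff)
    (hGZK : rank_eq_analyticRank_of_analyticRank_le_one) (hmod : hasEntireLFunction_rat)
    (hT : TameBranchRatDvdAt W p) (hX : ClassX4Gord W p) (hp5 : 5 ≤ p) (hr : W.analyticRank = 0)
    {N : ℕ} [NeZero N] {f : CuspForm (Gamma0 N) 2} {ε : DirichletCharacter ℂ_[p] p} {α : ℚ_[p]}
    {B : PowerSeries ℚ_[p]}
    (hf : IsNewformOf W f) (hε : orderOf ε = tameDefect W p) (hα : ‖α‖ = 1)
    (hB : IsTameBranchOf f p ε α B)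
    (hμ : ∀ (κ : ZpExtension ℚ p) (γ : Field.absoluteGaloisGroup ℚ),
      κ.IsCyclotomic → κ.IsTopGenerator γ → IsCyclotomicVariable p γ →
      ∀ (D : W.SelmerDualData κ γ) (g : IwasawaAlgebra p), D.charIdeal = Ideal.span {g} →
        HasUnitContent g)
    (hint : ∀ n : ℕ, ‖PowerSeries.coeff n B‖ ≤ 1)
    {q : ℚ} (hq : W.entireLFunction 1 = (q : ℂ) * (W.realPeriodRat : ℂ))
    {u : ℤ_[p]ˣ} (hu : α⁻¹ * (ratPlusSymbol f 0 : ℚ_[p]) = ((u : ℤ_[p]) : ℚ_[p]) * (q : ℚ_[p]))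
    {s : ℚ} (hs : shaAn W = (s : ℂ)) (hv : padicValRat p s = 0) : BSDp W p :=
  ClassX4Gord.bsdp_rankZero_of_cycLeadingTerm_of_shaAn_unit hDel hGZK hmod hX hp5 hr
    (cycLeadingTermAt_of_tameBranchRatDvdAt_of_hasUnitContent_of_integral hT hX.addv.1 hX.addv.2
      (Or.inr hX.typeGOrd) hf hε hα hB hμ hint hq hu) hs hv

/-- **END (PRINTED inputs).** Same, with the typed Kato half DISCHARGED from Delbourgo 2002 Theorems
(A)+(C) (`tameBranchRatDvdAt_of_thmC`: A175/A176 + the (C) record; non-CM, `p ≥ 5`): on an X4♯(G-ord)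
row at analytic rank `0` with `ord_p #Ш_an = 0`, `BSD(E,p)` follows from PRINTED facts plus the
per-row inputs {tame-branch tuple, `B` `p`-integral, `μ^alg(E/ℚ_∞) = 0`, UPPER unit period binder}.
Nothing booked; the row inputs are EVIDENCE/instrument tier until certified.
[cite: Delbourgo2002, Theorem (A), (C) (p. 40)] [cite: Delbourgo1998, Prop. 4 (p. 144)] -/
theorem ClassX4Gord.bsdp_rankZero_of_thmC_of_hasUnitContent_of_integral_of_shaAn_unit
    (hC : Delbourgo2002.thmC_charIdeal_dvd_tameBranch)
    (hDelA : Delbourgo2002.mainTheorem) (hDelM : Delbourgo2002.mainTheorem_potMult)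
    (hDel : Delbourgo1998.prop4_rankZero_pow_dvd_constantCoeff)
    (hGZK : rank_eq_analyticRank_of_analyticRank_le_one) (hmod : hasEntireLFunction_rat)
    (hX : ClassX4Gord W p) (hp5 : 5 ≤ p) (hcm : ¬ W.HasCM) (hr : W.analyticRank = 0)
    {N : ℕ} [NeZero N] {f : CuspForm (Gamma0 N) 2} {ε : DirichletCharacter ℂ_[p] p} {α : ℚ_[p]}
    {B : PowerSeries ℚ_[p]}
    (hf : IsNewformOf W f) (hε : orderOf ε = tameDefect W p) (hα : ‖α‖ = 1)
    (hB : IsTameBranchOf f p ε α B)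
    (hμ : ∀ (κ : ZpExtension ℚ p) (γ : Field.absoluteGaloisGroup ℚ),
      κ.IsCyclotomic → κ.IsTopGenerator γ → IsCyclotomicVariable p γ →
      ∀ (D : W.SelmerDualData κ γ) (g : IwasawaAlgebra p), D.charIdeal = Ideal.span {g} →
        HasUnitContent g)
    (hint : ∀ n : ℕ, ‖PowerSeries.coeff n B‖ ≤ 1)
    {q : ℚ} (hq : W.entireLFunction 1 = (q : ℂ) * (W.realPeriodRat : ℂ))
    {u : ℤ_[p]ˣ} (hu : α⁻¹ * (ratPlusSymbol f 0 : ℚ_[p]) = ((u : ℤ_[p]) : ℚ_[p]) * (q : ℚ_[p]))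
    {s : ℚ} (hs : shaAn W = (s : ℂ)) (hv : padicValRat p s = 0) : BSDp W p :=
  ClassX4Gord.bsdp_rankZero_of_tameBranchRatDvdAt_of_hasUnitContent_of_integral_of_shaAn_unit hDel
    hGZK hmod (tameBranchRatDvdAt_of_thmC hC hDelA hDelM hp5 hcm) hX hp5 hr hf hε hα hB hμ hint hq
    hu hs hv

/-! ### §4 The `μ`-anchor interface: `μ(D.X) = 0` for every cyclotomic datum (the shape the
Greenberg–Vatsal congruent-pair forms `….mu_eq_zero_of_gv_…` deliver) feeds T1 -/

omit [W.IsGloballyMinimal] in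
/-- **Bridge `D.mu = 0` ⟹ unit-content generator.** For an elliptic `W`, a cyclotomic datum `D` over a
`ℤ_p`-extension with topological generator `γ` (so `X` is finitely generated,
`SelmerDualData.module_finite_holds`), `X` torsion and `μ(D.X) = 0`: every generator of `char_Λ X` has
unit content (`mu_generator_eq_muInvariant`; the generator is nonzero by `Module.charIdeal_ne_bot`).
[cite: Washington1997, §13.2] [cite: GreenbergVatsal2000, p. 2, (2)] -/
theorem hasUnitContent_of_charIdeal_eq_span_of_mu_zero {κ : ZpExtension ℚ p}
    {γ : Field.absoluteGaloisGroup ℚ} (hγ : κ.IsTopGenerator γ) (D : W.SelmerDualData κ γ)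
    (hX : D.IsTorsion) (hμ : D.mu = 0) {g : IwasawaAlgebra p}
    (hchar : D.charIdeal = Ideal.span {g}) : HasUnitContent g := by
  haveI : Module.Finite (IwasawaAlgebra p) D.X := D.module_finite_holds hγ
  have hg0 : g ≠ 0 := by
    intro h0
    apply Module.charIdeal_ne_bot (IwasawaAlgebra p) D.X
    change D.charIdeal = ⊥
    rw [hchar, h0]
    exact Ideal.span_singleton_eq_bot.mpr rfl
  have hμg : mu g = 0 := by
    rw [mu_generator_eq_muInvariant D.X hX hg0 hchar]
    exact hμ
  exact hasUnitContent_of_mu_eq_zero hg0 hμg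

/-- **T1, `μ`-anchor form.** `CycLeadingTermAt W p` from the typed Kato half `TameBranchRatDvdAt W p`,
a `p`-integral tame branch, the UPPER unit period binder, and **`μ(X(W/ℚ_∞)) = 0` for EVERY
cyclotomic Pontryagin-dual datum** (`hμ0`, in `SelmerDualData.mu` currency — the conclusion shape of
the congruent-pair μ-transfer forms `ClassX4Gord./ClassX3Gord.mu_eq_zero_of_gv_…`, i.e. p07's T2
brick composed with T3 at the partner); torsion of `X` comes from `hT` itself (Delbourgo 2002 (A)).
[cite: Delbourgo2002, Theorem (A), (C) (p. 40)] [cite: Delbourgo1998, Main Conjecture (p. 151) (divisibility direction at `T = 0`; shape)] -/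
theorem cycLeadingTermAt_of_tameBranchRatDvdAt_of_mu_zero_of_integral
    (hT : TameBranchRatDvdAt W p)
    {N : ℕ} [NeZero N] {f : CuspForm (Gamma0 N) 2} {ε : DirichletCharacter ℂ_[p] p} {α : ℚ_[p]}
    {B : PowerSeries ℚ_[p]}
    (hp2 : p ≠ 2) (hadd : Addv W p) (hloc : PotMult W p ∨ TypeGOrd W p)
    (hf : IsNewformOf W f) (hε : orderOf ε = tameDefect W p) (hα : ‖α‖ = 1)
    (hB : IsTameBranchOf f p ε α B)
    (hμ0 : ∀ (κ : ZpExtension ℚ p) (γ : Field.absoluteGaloisGroup ℚ),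
      κ.IsCyclotomic → κ.IsTopGenerator γ → IsCyclotomicVariable p γ →
      ∀ D : W.SelmerDualData κ γ, D.IsTorsion → D.mu = 0)
    (hint : ∀ n : ℕ, ‖PowerSeries.coeff n B‖ ≤ 1)
    {q : ℚ} (hq : W.entireLFunction 1 = (q : ℂ) * (W.realPeriodRat : ℂ))
    {u : ℤ_[p]ˣ} (hu : α⁻¹ * (ratPlusSymbol f 0 : ℚ_[p]) = ((u : ℤ_[p]) : ℚ_[p]) * (q : ℚ_[p])) :
    CycLeadingTermAt W p :=
  cycLeadingTermAt_of_tameBranchRatDvdAt_of_hasUnitContent_of_integral hT hp2 hadd hloc hf hε hα hB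
    (fun κ γ hκ hγ hcv D _ hchar ↦
      hasUnitContent_of_charIdeal_eq_span_of_mu_zero hγ D
        (isTorsion_of_tameBranchRatDvdAt hT hp2 hadd hloc hf hε hα hB hκ hγ hcv D)
        (hμ0 κ γ hκ hγ hcv D (isTorsion_of_tameBranchRatDvdAt hT hp2 hadd hloc hf hε hα hB hκ hγ hcv D))
        hchar)
    hint hq hu

/-- **END, `μ`-anchor form, PRINTED inputs.** X4♯(G-ord), EVERY defect, `p ≥ 5`, non-CM, analytic rank
`0`, `ord_p #Ш_an = 0`: `BSD(E,p)` from Delbourgo 2002 (A)+(C) + Delbourgo 1998 Prop. 4 + GZK +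
modularity and the per-row inputs {tame-branch tuple, `B` `p`-integral, `μ(X(W/ℚ_∞)) = 0` for every
cyclotomic datum, UPPER unit period binder}. Nothing booked; row inputs are EVIDENCE until certified.
[cite: Delbourgo2002, Theorem (A), (C) (p. 40)] [cite: Delbourgo1998, Prop. 4 (p. 144)] -/
theorem ClassX4Gord.bsdp_rankZero_of_thmC_of_mu_zero_of_integral_of_shaAn_unit
    (hC : Delbourgo2002.thmC_charIdeal_dvd_tameBranch)
    (hDelA : Delbourgo2002.mainTheorem) (hDelM : Delbourgo2002.mainTheorem_potMult)
    (hDel : Delbourgo1998.prop4_rankZero_pow_dvd_constantCoeff)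
    (hGZK : rank_eq_analyticRank_of_analyticRank_le_one) (hmod : hasEntireLFunction_rat)
    (hX : ClassX4Gord W p) (hp5 : 5 ≤ p) (hcm : ¬ W.HasCM) (hr : W.analyticRank = 0)
    {N : ℕ} [NeZero N] {f : CuspForm (Gamma0 N) 2} {ε : DirichletCharacter ℂ_[p] p} {α : ℚ_[p]}
    {B : PowerSeries ℚ_[p]}
    (hf : IsNewformOf W f) (hε : orderOf ε = tameDefect W p) (hα : ‖α‖ = 1)
    (hB : IsTameBranchOf f p ε α B)
    (hμ0 : ∀ (κ : ZpExtension ℚ p) (γ : Field.absoluteGaloisGroup ℚ),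
      κ.IsCyclotomic → κ.IsTopGenerator γ → IsCyclotomicVariable p γ →
      ∀ D : W.SelmerDualData κ γ, D.IsTorsion → D.mu = 0)
    (hint : ∀ n : ℕ, ‖PowerSeries.coeff n B‖ ≤ 1)
    {q : ℚ} (hq : W.entireLFunction 1 = (q : ℂ) * (W.realPeriodRat : ℂ))
    {u : ℤ_[p]ˣ} (hu : α⁻¹ * (ratPlusSymbol f 0 : ℚ_[p]) = ((u : ℤ_[p]) : ℚ_[p]) * (q : ℚ_[p]))
    {s : ℚ} (hs : shaAn W = (s : ℂ)) (hv : padicValRat p s = 0) : BSDp W p :=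
  ClassX4Gord.bsdp_rankZero_of_cycLeadingTerm_of_shaAn_unit hDel hGZK hmod hX hp5 hr
    (cycLeadingTermAt_of_tameBranchRatDvdAt_of_mu_zero_of_integral
      (tameBranchRatDvdAt_of_thmC hC hDelA hDelM hp5 hcm) hX.addv.1 hX.addv.2 (Or.inr hX.typeGOrd)
      hf hε hα hB hμ0 hint hq hu) hs hv

end TameBranch

end Summit.BirchSwinnertonDyer.Rank1Residual.Additive

end
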